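import Summits.QuantumFields.YangMills.Theorems.BalabanUVNodesN19ConstantsWindowU2Output
import HarnessLib

/-!
# BalabanUVNodes ∕ N19 other kinds through node U5b — the RECENT RATED LEDGER of the other kinds (boundary pieces, 𝐑-pieces,
# inserted quotients, pending values: every located kind of `T4RecentScale.Kind` except the E-ledger, the constants and the
# action) peeled off by the tree's node-U5b statement `T4RecentScale.FactorLogRatio` on the log window; the N19 knit v4 in
# node U2's OUTPUT letter (cell `pub-ymgap`, D-0062 Track A, cluster K5, seat dag-n19-a gen 2; count-neutral)

HONEST FRAMING.  One fixed finite four-torus, rung (B)+1 — NOT infinite volume, NOT a mass gap, NOT the Clay problem.  NE7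
(node U5; NE7-proper leaf `Spine.NE7.Core`) is NOT PRINTED in [Balaban1987RG1]–[Balaban1989LargeFieldII] and NOT PROVED here.
Every analytic input is a HYPOTHESIS SHAPE of the tree consumed BY NAME; nothing of Bałaban's objects is instantiated; no
`def`, 0 `sorry`, standard axioms.  NOT a node discharge: a `--supports` helper for crux `SpineGivenEndpoint` (19182).

WHAT THIS ADDS TO `BalabanUVNodesN19ConstantsWindowU2Output` (p412947).  After v3′ the other kinds that still carry an
unstructured centre clause (O″) are: the boundary pieces `exp 𝐁^{(j)}(X, U_k, A, {S_i∩X})` ((2.40)–(2.42) p. 261 of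
[Balaban1988Convergent]; the new boundary terms (1.98)–(1.101) p. 390 of [Balaban1989LargeFieldII]), the 𝐑-pieces
((2.30)–(2.31) p. 260), the inserted small-field quotients, the pending T-values, run B's unmatched first step, N14's
observable-attached D-terms and the large-field operations' normalization constants (p. 380).  The tree types the first four
as ONE statement — node U5b, `T4RecentScale.FactorLogRatio Adm fac kind sc w f^A f^B c Ck θ δ`: on the admissible set every
factor of the ledger is positive in both runs and `|log f^B_i − log f^A_i − c_i| ≤ Ck(kind i)(θ^{sc i} + δ)w_i` (NOT PRINTED;
row T4-U3.B `T4GoodClassBudget.BoundaryRate` is its all-boundary instance; `T4BoundaryCarrier.factorLogRatio_boundary` the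
boundary carrier's producer).  For a GOOD term these pieces live near its large-field structures, i.e. in the RECENT window
(the booking again, `RecentOnly`), with window multiplicity; so their whole two-run log-ratio is `vol ×` a WINDOW SUM
(`T4GoodClassBudget.sum_rate_le_windowSum`, as in `boundary_log_prod_le`), summable for every `θ′ < 1` on the log window, and
their constants `c_i` — rate-small where they exist (the 𝐑-pieces are `1`-subtracted like the E-pieces; boundary pieces carry
none) — deviate by the same window sum (`N19ConstantsWindow.recentDeviation_of_constRate`).  Hence:
* §1 `u5bLedger_log_prod_le` — node U5b on a recent ledger with ONE kind constant `CO`, `δ ≡ 0` ⇒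
  `|log Π f^B − log Π f^A − Σ c_i| ≤ vol·(CO·Cw·windowSum θ Λ j⋆ K)`; `u5bLedger_const_le` — rate-small constants ⇒
  `|Σ c_i| ≤ vol·(Cs·Cw·windowSum θ Λ j⋆ K)`.
* §2 `core_summable_of_nodes_u5b` — THE KNIT v4 (U2-OUTPUT letter), a corollary of v3′ BY NAME: other kinds
  `o = exp(Σ_{ledger}E(·;g,1)) · exp(−R.act) · (Π_{recent U5b ledger} f) · o″`, node U5b's statement + booking + window
  multiplicity + rate-small constants for that ledger, and the centre clause (O‴) asked only of `o″` ⇒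
  `∃ δ, Spine.NE7.Core l₀ vol T Bad A B δ ∧ Summable δ`.
* §3 non-vacuity (a genuine one-piece boundary ledger `{K}` with factors `e^{−q^K}`, `e^{−q^{K+1}}` on the toy nodes).

BINDER CENSUS OF THE EDGE AFTER THIS FILE.  By name from the DAG nodes: N16 (both conjuncts) · N17 (U2's output) · N18 · N22 (+ `hone`).
By name from the tree's ROW statements: node U5b `FactorLogRatio` for the recent other kinds (rows T4-U3.B ∕ NE5-R ∕ insert ∕ pending —
NOT DAG nodes, NOT printed as two-run statements).  Remaining: (F) term format + reference ledger + booking + the U5b ledger's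
recency (object-bound, NODE O); (O‴) = run B's unmatched first step · N14's observable-attached D-terms (no two-run D-rate is
typed; N14's record decl `DressedStabilityStrict` is a one-run stability) · the large-field operations' normalization constants
(p. 380; NE7b∕c's species) — each a centre-clause hypothesis `hO″ hRO″ hrO″ hcO″`; (S)(M)(T) printed-grade.

CITATION HEADER (LOCATIONS only, as transcribed in the imported modules; no decl carries a cite tag).  [Balaban1988Convergent]
T. Bałaban, CMP **119** (1988) 243–285 — (2.25)–(2.27) p. 259, (2.30)–(2.31) p. 260, (2.40)–(2.42) p. 261, p. 262, Thm 2
(2.43) p. 263.  [Balaban1987RG1] CMP **109** (1987) 249–301 — (0.26) p. 257, Thm 1 p. 259.  [Balaban1989LargeFieldI] CMP **122**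
(1989) 175–202 — (1.100) p. 201.  [Balaban1989LargeFieldII] CMP **122** (1989) 355–392 — p. 380, (1.98)–(1.101) p. 390.
-/

open Finset MeasureTheory

namespace Summit.QuantumFields.YangMills.BalabanUVNodes.N19OtherKindsU5b

open Literature.MathematicalPhysics.QuantumFieldTheory.Balaban1983to89
open T4OutputRate T4RecentScale T4GoodClassBudget T4CauchySum T4TowerRateComposition T4TowerRateDischarge
open T4EtaRateMin (Readings LocalRate NE3Shape)
open T4RateLiaison (GaugeDominated)
open Summit.QuantumFields.BalabanUV.T4Continuum.Spine
open Summit.QuantumFields.YangMills.BalabanUVNodes.N19ConstantsWindow (recentDeviation_of_constRate)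
open Summit.QuantumFields.YangMills.BalabanUVNodes.N19ConstantsWindowU2Output (core_summable_of_nodes_window)

/-! ## §1 Node U5b on a recent ledger: the whole log-ratio and the constants are `vol ×` window sums -/

section Ledger

variable {F V : Type*} {Adm : Set V} {fac : Finset F} {kind : F → Kind} {sc : F → ℕ} {w : F → ℝ}
  {fA fB : F → V → ℝ} {c : F → ℝ} {CO Cs θ Cw vol Λ : ℝ} {jstar K : ℕ}

/-- **NODE U5b ON A RECENT LEDGER ⇒ THE TWO-RUN LOG-RATIO IS `vol ×` A WINDOW SUM.**  Node U5b's statement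
`FactorLogRatio Adm fac kind sc w f^A f^B c (fun _ => CO) θ 0` (any kinds, ONE kind constant `CO ≥ 0`, discrepancy `δ ≡ 0`)
on a RECENT-ONLY ledger with window multiplicity gives, on the admissible set,
`|log Π f^B − log Π f^A − Σ c_i| ≤ vol·(CO·Cw·windowSum θ Λ j⋆ K)` (`FactorLogBound.log_prod` + `recentProfile_le_rate` +
`sum_rate_le_windowSum`, exactly as `T4GoodClassBudget.boundary_log_prod_le` for the boundary kind). [folklore] -/
theorem u5bLedger_log_prod_le (hU5b : FactorLogRatio Adm fac kind sc w fA fB c (fun _ => CO) θ (fun _ => 0))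
    (hCO : 0 ≤ CO) (hθ : 0 ≤ θ) (hw : ∀ i ∈ fac, 0 ≤ w i) (hrec : RecentOnly fac sc jstar K)
    (hM : WindowMultiplicity fac sc w Cw vol Λ jstar K) :
    ∀ v ∈ Adm, |Real.log (∏ i ∈ fac, fB i v) - Real.log (∏ i ∈ fac, fA i v) - ∑ i ∈ fac, c i|
      ≤ vol * (CO * Cw * windowSum θ Λ jstar K) := by
  have hB : FactorLogBound Adm fac fA fB c (recentProfile kind sc w (fun _ => CO) θ (fun _ => 0)) := hU5b
  have hδ : InjectedRate 0 0 θ (fun _ _ => (0 : ℝ)) := injectedRate_zero hθ le_rfl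
  intro v hv
  refine (hB.log_prod v hv).trans ?_
  calc ∑ i ∈ fac, recentProfile kind sc w (fun _ => CO) θ (fun _ => 0) i
      ≤ ∑ i ∈ fac, CO * (1 + 0) * θ ^ sc i * w i := Finset.sum_le_sum fun i hi =>
        recentProfile_le_rate (kind := kind) (Ck := fun _ => CO) (δ := fun _ _ => 0) hδ (K := K) (hrec i hi).2 hCO
          (hw i hi)
    _ ≤ CO * (1 + 0) * (Cw * vol) * windowSum θ Λ jstar K :=
        sum_rate_le_windowSum (mul_nonneg hCO (by norm_num)) hθ hrec hM
    _ = vol * (CO * Cw * windowSum θ Λ jstar K) := by ring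

/-- **THE LEDGER'S CONSTANTS DEVIATE BY THE SAME WINDOW SUM**: rate-small constants `|c_i| ≤ Cs θ^{sc i} w_i` on a recent-only
ledger with window multiplicity ⇒ `|Σ c_i| ≤ vol·(Cs·Cw·windowSum θ Λ j⋆ K)` (`N19ConstantsWindow.recentDeviation_of_constRate` +
`abs_sum_dev_le_windowSum`). [folklore] -/
theorem u5bLedger_const_le (hw : ∀ i ∈ fac, 0 ≤ w i) (hc : ∀ i ∈ fac, |c i| ≤ Cs * θ ^ sc i * w i) (hCs : 0 ≤ Cs)
    (hθ : 0 ≤ θ) (hrec : RecentOnly fac sc jstar K) (hM : WindowMultiplicity fac sc w Cw vol Λ jstar K) :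
    |∑ i ∈ fac, c i| ≤ vol * (Cs * Cw * windowSum θ Λ jstar K) :=
  calc |∑ i ∈ fac, c i| ≤ Cs * (1 + 0) * (Cw * vol) * windowSum θ Λ jstar K :=
        abs_sum_dev_le_windowSum (δ := fun _ _ => 0) (recentDeviation_of_constRate hw hc hrec hM)
          (injectedRate_zero hθ le_rfl) hCs le_rfl hθ
    _ = vol * (Cs * Cw * windowSum θ Λ jstar K) := by ring

end Ledger

/-! ## §2 THE KNIT v4 (U2-OUTPUT letter): the recent U5b ledger of other kinds peeled off, (O‴) for the rest -/

section SpineNodes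

variable {C : Carriers} [DecidableEq C.Dom] {F : Type*} {ι X : Type} [MeasurableSpace ι] {σ : Type*} [DecidableEq σ]
  {l₀ vol : ℝ} {T : ℕ → Finset σ} {Bad : ℕ → ℝ → Finset σ} {A B : ℕ → ℝ → σ → ℝ} {μ : ℕ → ℝ → σ → Measure ι}
  {fac : ℕ → ℝ → σ → Finset C.Dom} {All : ℕ → Finset C.Dom} {facO : ℕ → ℝ → σ → Finset F} {kindO : F → Kind}
  {scO : F → ℕ} {wO : F → ℝ} {R : Readings ι X} {W : Set (ℕ → ℝ)} {EA : Functional C C.BgA} {EB : Functional C C.BgB}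
  {κ θ₅ C₅ C₉ ω θc Cd γ C₃ θ₃ Pg θ' Cl CO Cs : ℝ} {q m : ℕ} {Λm : ℕ → ℕ → ℝ} {CU : (ℕ → ℝ) → ℕ → ℝ} {g : ℕ → ℕ → ℝ}
  {uA : ℕ → ι → C.BgA} {uB : ℕ → ι → C.BgB} {oneA : C.BgA} {oneB : C.BgB} {oA oB oA'' oB'' : ℕ → ℝ → σ → ι → ℝ}
  {ofA ofB : ℕ → ℝ → σ → F → ι → ℝ} {cf : ℕ → ℝ → σ → F → ℝ} {S : ℕ → ℝ → σ → ℕ → ℝ} {cO'' RO'' : ℕ → ℝ → σ → ℝ}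
  {rO'' : ℕ → ℝ} {Cw E₀ a Λ : ℝ}

/-- **N19 KNIT v4, U2-OUTPUT LETTER — THE RECENT U5b LEDGER OF OTHER KINDS PEELED OFF.**  Hypotheses: those of
`N19ConstantsWindowU2Output.core_summable_of_nodes_window` (N16 `NE3Shape` both conjuncts + `GaugeDominated`; N18; N22; N17 as
node U2's output on the box; printed bracket; window; common rate; format; τ-free reference ledger with (0.26) multiplicity;
booking; `R.vol ≤ vol`; zero-centred size binder; `hone`) EXCEPT that the remaining kinds are written
`o′ = (Π_{i ∈ facO K t τ} f_i) · o″` with: `hU5b` — node U5b's statement `FactorLogRatio R.dom (facO K t τ) kindO scO wO (f^A) (f^B)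
(cf K t τ) (fun _ => CO) θ′ 0` for every good term (rows T4-U3.B ∕ NE5-R ∕ insert ∕ pending BY THE TREE's NAME, not DAG nodes);
`hwO` nonnegative weights; `hOrec` — those pieces are RECENT (`RecentOnly (facO K t τ) scO (jlog_{Cl} K) K`, the booking); `hOM` —
window multiplicity; `hcf` — their constants are rate-small `|cf i| ≤ Cs θ′^{scO i} wO i`; and (O‴) `hO″ hRO″ hrO″ hcO″` for `o″`.
CONCLUSION: `∃ δ, Spine.NE7.Core l₀ vol T Bad A B δ ∧ Summable δ` — N19 BY NAME ∧ node U4′'s summable leaf.  Proof: v3′ with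
`cO′ := Σ_{facO} cf + cO″`, `RO′ := vol·(CO·Cw·W_K) + RO″`, `rO′ := CO·Cw·W_K + rO″`, §1, `summable_windowSum_log`.  CONDITIONAL on
every binder; NOT NE7. [folklore] -/
theorem core_summable_of_nodes_u5b
    (h16 : NE3Shape R C₃ θ₃) (hC₃ : 0 ≤ C₃) (hgd : GaugeDominated R uA uB)
    (h18 : NE5 EA EB W κ θ₅ C₅) (hθ₅ : 0 ≤ θ₅) (hC₅ : 0 ≤ C₅)
    (h22 : NE9 EA W κ Λm ∧ T4OutputRate.FadingMemory C₉ ω Λm) (hω : 0 ≤ ω)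
    (hinj : InjectedRate Cd 0 θc (fun K j => T4CouplingMatching.disc (g K) (g (K + 1)) j)) (hCd : 0 ≤ Cd)
    (hθc : 0 ≤ θc) (hbox : ∀ K i, i ≤ K → 0 < g K i ∧ g K i ≤ γ)
    (hU : LipBackground EA W κ CU) (hG : PolyLipGrowth CU g Pg q) (hPg : 0 ≤ Pg)
    (hgA : ∀ K, g K ∈ W) (hgB : ∀ K, (fun i => g (K + 1) (i + 1)) ∈ W)
    (hθ' : max ω θc < θ') (hθ₅' : θ₅ ≤ θ') (hθ₃' : θ₃ ≤ θ') (hθ'1 : θ' < 1) (hθ'Λ : θ' ≤ Λ) (hΛ1 : 1 ≤ Λ)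
    (hfmtA : ∀ K t τ, A K t τ = ∫ v, (∏ X ∈ fac K t τ,
      Real.exp (EA (g K) (uA K v) X - EA (g K) oneA X)) * oA K t τ v ∂(μ K t τ))
    (hfmtB : ∀ K t τ, B K t τ = ∫ v, (∏ X ∈ fac K t τ,
      Real.exp (EB (fun i => g (K + 1) (i + 1)) (uB K v) X - EB (fun i => g (K + 1) (i + 1)) oneB X)) *
        oB K t τ v ∂(μ K t τ))
    (hint : ∀ K t, |t| ≤ l₀ → ∀ τ ∈ T K \ Bad K t,
      Integrable (fun v => (∏ X ∈ fac K t τ, Real.exp (EA (g K) (uA K v) X - EA (g K) oneA X)) *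
        oA K t τ v) (μ K t τ) ∧
      Integrable (fun v => (∏ X ∈ fac K t τ,
        Real.exp (EB (fun i => g (K + 1) (i + 1)) (uB K v) X - EB (fun i => g (K + 1) (i + 1)) oneB X)) *
        oB K t τ v) (μ K t τ))
    (hoff : ∀ K t, |t| ≤ l₀ → ∀ τ ∈ T K \ Bad K t, ∀ v, v ∉ R.dom →
      (∏ X ∈ fac K t τ, Real.exp (EA (g K) (uA K v) X - EA (g K) oneA X)) * oA K t τ v = 0 ∧
      (∏ X ∈ fac K t τ,
        Real.exp (EB (fun i => g (K + 1) (i + 1)) (uB K v) X - EB (fun i => g (K + 1) (i + 1)) oneB X)) *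
        oB K t τ v = 0)
    (hAll : ∀ K t, |t| ≤ l₀ → ∀ τ ∈ T K \ Bad K t, fac K t τ ⊆ All K)
    (hAllsc : ∀ K, ∀ X ∈ All K, C.scale X ≤ K)
    (hMAll : ∀ K, Multiplicity (All K) C.scale (fun X => Real.exp (-(κ * C.d X))) Cw vol Λ K)
    (hCl : 0 ≤ Cl)
    (hrecent : ∀ K t, |t| ≤ l₀ → ∀ τ ∈ T K \ Bad K t, RecentOnly (All K \ fac K t τ) C.scale (jlogOf Cl K) K)
    -- NEW in v4: the other kinds = constants × action × (the RECENT U5b LEDGER of other kinds) × o″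
    (hOfmtA : ∀ K t τ v, oA K t τ v = Real.exp (∑ X ∈ fac K t τ, EA (g K) oneA X) *
      (Real.exp (-(R.act K v)) * ((∏ i ∈ facO K t τ, ofA K t τ i v) * oA'' K t τ v)))
    (hOfmtB : ∀ K t τ v, oB K t τ v = Real.exp (∑ X ∈ fac K t τ, EB (fun i => g (K + 1) (i + 1)) oneB X) *
      (Real.exp (-(R.act (K + 1) v)) * ((∏ i ∈ facO K t τ, ofB K t τ i v) * oB'' K t τ v)))
    (hU5b : ∀ K t, |t| ≤ l₀ → ∀ τ ∈ T K \ Bad K t,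
      FactorLogRatio R.dom (facO K t τ) kindO scO wO (ofA K t τ) (ofB K t τ) (cf K t τ) (fun _ => CO) θ' (fun _ => 0))
    (hCO : 0 ≤ CO) (hwO : ∀ i, 0 ≤ wO i)
    (hOrec : ∀ K t, |t| ≤ l₀ → ∀ τ ∈ T K \ Bad K t, RecentOnly (facO K t τ) scO (jlogOf Cl K) K)
    (hOM : ∀ K t, |t| ≤ l₀ → ∀ τ ∈ T K \ Bad K t, WindowMultiplicity (facO K t τ) scO wO Cw vol Λ (jlogOf Cl K) K)
    (hcf : ∀ K t, |t| ≤ l₀ → ∀ τ ∈ T K \ Bad K t, ∀ i ∈ facO K t τ, |cf K t τ i| ≤ Cs * θ' ^ scO i * wO i)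
    (hCs : 0 ≤ Cs)
    (hposO'' : ∀ K t, |t| ≤ l₀ → ∀ τ ∈ T K \ Bad K t, ∀ v ∈ R.dom, 0 < oA'' K t τ v ∧ 0 < oB'' K t τ v)
    (hRvol : R.vol ≤ vol)
    (hS : ∀ K t, |t| ≤ l₀ → ∀ τ ∈ T K \ Bad K t, ∀ v ∈ R.dom, ∀ j ≤ K,
      |∑ X ∈ fac K t τ with C.scale X = j,
          (Real.log (Real.exp (EB (fun i => g (K + 1) (i + 1)) (uB K v) X
              - EB (fun i => g (K + 1) (i + 1)) oneB X))
            - Real.log (Real.exp (EA (g K) (uA K v) X - EA (g K) oneA X)))| ≤ S K t τ j)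
    (hvol : 0 ≤ vol) (hE₀ : 0 ≤ E₀) (ha0 : 0 < a) (ha1 : a < 1)
    (hSle : ∀ K t, |t| ≤ l₀ → ∀ τ ∈ T K \ Bad K t, ∀ j ≤ K,
      S K t τ j ≤ vol * (E₀ * ((K : ℝ) + 1) ^ m * a ^ (K - j)))
    -- (O‴): the REMAINING kinds (run B's first step, N14's D-terms, LF normalization constants) with a class-constant centre clause
    (hO'' : ∀ K t, |t| ≤ l₀ → ∀ τ ∈ T K \ Bad K t, ∀ v ∈ R.dom,
      |Real.log (oB'' K t τ v) - Real.log (oA'' K t τ v) - cO'' K t τ| ≤ RO'' K t τ)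
    (hRO'' : ∀ K t, |t| ≤ l₀ → ∀ τ ∈ T K \ Bad K t, RO'' K t τ ≤ vol * rO'' K) (hrO'' : Summable rO'')
    (hone : C.transport oneB = oneA)
    (hcO'' : ∃ c₀ s : ℕ → ℝ, Summable s ∧ ∀ K t, |t| ≤ l₀ → ∀ τ ∈ T K \ Bad K t, |cO'' K t τ - c₀ K| ≤ vol * s K) :
    ∃ δ : ℕ → ℝ, NE7.Core l₀ vol T Bad A B δ ∧ Summable δ := by
  have hθ'0 : 0 < θ' := lt_of_le_of_lt (hθc.trans (le_max_right ω θc)) hθ'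
  have hWsum := summable_windowSum_log (Λ := Λ) hθ'0 hθ'1 hΛ1 hCl
  -- §1 on every good term: the U5b ledger's log-ratio and its constants are `vol ×` window sums
  have hlog : ∀ K t, |t| ≤ l₀ → ∀ τ ∈ T K \ Bad K t, ∀ v ∈ R.dom,
      |Real.log (∏ i ∈ facO K t τ, ofB K t τ i v) - Real.log (∏ i ∈ facO K t τ, ofA K t τ i v)
        - ∑ i ∈ facO K t τ, cf K t τ i| ≤ vol * (CO * Cw * windowSum θ' Λ (jlogOf Cl K) K) :=
    fun K t ht τ hτ => u5bLedger_log_prod_le (hU5b K t ht τ hτ) hCO hθ'0.le (fun i _ => hwO i) (hOrec K t ht τ hτ)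
      (hOM K t ht τ hτ)
  have hcst : ∀ K t, |t| ≤ l₀ → ∀ τ ∈ T K \ Bad K t,
      |∑ i ∈ facO K t τ, cf K t τ i| ≤ vol * (Cs * Cw * windowSum θ' Λ (jlogOf Cl K) K) := fun K t ht τ hτ =>
    u5bLedger_const_le (fun i _ => hwO i) (hcf K t ht τ hτ) hCs hθ'0.le (hOrec K t ht τ hτ) (hOM K t ht τ hτ)
  have hfpos : ∀ K t, |t| ≤ l₀ → ∀ τ ∈ T K \ Bad K t, ∀ v ∈ R.dom,
      0 < ∏ i ∈ facO K t τ, ofA K t τ i v ∧ 0 < ∏ i ∈ facO K t τ, ofB K t τ i v := fun K t ht τ hτ v hv =>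
    ⟨prod_pos fun i hi => (hU5b K t ht τ hτ v hv i hi).1, prod_pos fun i hi => (hU5b K t ht τ hτ v hv i hi).2.1⟩
  obtain ⟨c₀'', s'', hs'', hcO'''⟩ := hcO''
  refine core_summable_of_nodes_window (oA := oA) (oB := oB)
    (oA' := fun K t τ v => (∏ i ∈ facO K t τ, ofA K t τ i v) * oA'' K t τ v)
    (oB' := fun K t τ v => (∏ i ∈ facO K t τ, ofB K t τ i v) * oB'' K t τ v)
    (cO' := fun K t τ => (∑ i ∈ facO K t τ, cf K t τ i) + cO'' K t τ)
    (RO' := fun K t τ => vol * (CO * Cw * windowSum θ' Λ (jlogOf Cl K) K) + RO'' K t τ)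
    (rO' := fun K => CO * Cw * windowSum θ' Λ (jlogOf Cl K) K + rO'' K)
    h16 hC₃ hgd h18 hθ₅ hC₅ h22 hω hinj hCd hθc hbox hU hG hPg hgA hgB hθ' hθ₅' hθ₃' hθ'1 hθ'Λ hΛ1 hfmtA hfmtB hint hoff
    hAll hAllsc hMAll hCl hrecent hOfmtA hOfmtB
    (fun K t ht τ hτ v hv => ⟨mul_pos (hfpos K t ht τ hτ v hv).1 (hposO'' K t ht τ hτ v hv).1,
      mul_pos (hfpos K t ht τ hτ v hv).2 (hposO'' K t ht τ hτ v hv).2⟩)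
    hRvol hS hvol hE₀ ha0 ha1 hSle (fun K t ht τ hτ v hv => ?_)
    (fun K t ht τ hτ => by rw [mul_add]; exact add_le_add le_rfl (hRO'' K t ht τ hτ))
    ((hWsum.mul_left (CO * Cw)).add hrO'') hone
    ⟨c₀'', fun K => Cs * Cw * windowSum θ' Λ (jlogOf Cl K) K + s'' K, (hWsum.mul_left (Cs * Cw)).add hs'',
      fun K t ht τ hτ => ?_⟩
  · -- `hO′`: U5b ledger (window sum) + the remaining kinds
    obtain ⟨hfA, hfB⟩ := hfpos K t ht τ hτ v hv
    obtain ⟨hA, hB⟩ := hposO'' K t ht τ hτ v hv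
    rw [Real.log_mul hfB.ne' hB.ne', Real.log_mul hfA.ne' hA.ne']
    have e : Real.log (∏ i ∈ facO K t τ, ofB K t τ i v) + Real.log (oB'' K t τ v)
        - (Real.log (∏ i ∈ facO K t τ, ofA K t τ i v) + Real.log (oA'' K t τ v))
        - ((∑ i ∈ facO K t τ, cf K t τ i) + cO'' K t τ)
        = (Real.log (∏ i ∈ facO K t τ, ofB K t τ i v) - Real.log (∏ i ∈ facO K t τ, ofA K t τ i v)
            - ∑ i ∈ facO K t τ, cf K t τ i)
          + (Real.log (oB'' K t τ v) - Real.log (oA'' K t τ v) - cO'' K t τ) := by ring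
    rw [e]
    exact (abs_add_le _ _).trans (add_le_add (hlog K t ht τ hτ v hv) (hO'' K t ht τ hτ v hv))
  · -- `hcO′`: the ledger's constants (window sum) + the remaining kinds' centre deviation
    have e : (∑ i ∈ facO K t τ, cf K t τ i) + cO'' K t τ - c₀'' K
        = (∑ i ∈ facO K t τ, cf K t τ i) + (cO'' K t τ - c₀'' K) := by ring
    rw [e, mul_add]
    exact (abs_add_le _ _).trans (add_le_add (hcst K t ht τ hτ) (hcO''' K t ht τ hτ))

end SpineNodes

/-! ## §3 Non-vacuity: a genuine one-piece boundary ledger on the tree's toy nodes -/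

section Sanity

/-- **NON-VACUITY OF THE KNIT v4.**  The toy nodes of `N19ConstantsWindowU2Output.nodes_window_nonvacuous` (constant couplings,
U2's output with `Cd = 0`, any `C₅ ≥ 0`) with a GENUINE recent ledger of other kinds: one boundary piece per cutoff, index `K`
(scale `K`, weight `1`), factors `e^{−q^K}` (run A) and `e^{−q^{K+1}}` (run B), constants `0` — node U5b's statement holds with
`CO = 1` at the common rate `(1+q)∕2` (`|−q^{K+1} + q^K| = (1−q)q^K`), the piece is recent and of window multiplicity `1`;
hence the cores now carry the boundary factor, ALL binders of `core_summable_of_nodes_u5b` are met and the knit fires.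
Consistency of the binder SET only; no physics. [folklore] -/
theorem nodes_u5b_nonvacuous {q γ C₅ : ℝ} (hq0 : 0 < q) (hq1 : q < 1) (hγ : 0 < γ) (hC₅ : 0 ≤ C₅) :
    ∃ δ : ℕ → ℝ, NE7.Core (ι := Unit) 1 1 (fun _ => Finset.univ) (fun _ _ => ∅)
        (fun K _ _ => ∫ _v, (∏ X ∈ range (K + 1),
          Real.exp (toyEA q q (fun _ => γ) (q ^ K) X - toyEA q q (fun _ => γ) 0 X)) * Real.exp (-(q ^ K))
          ∂(Measure.dirac ()))
        (fun K _ _ => ∫ _v, (∏ X ∈ range (K + 1),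
          Real.exp (toyEB q q C₅ (fun _ => γ) (q ^ (K + 1)) X - toyEB q q C₅ (fun _ => γ) 0 X)) * Real.exp (-(q ^ (K + 1)))
          ∂(Measure.dirac ()))
        δ ∧ Summable δ := by
  obtain ⟨h9, hΛ, hU, h5⟩ := toy_nonvacuous (C₅ := C₅) hq0.le hq1.le hq0.le hC₅
  obtain ⟨hloc, hgd, hinj, hbox, hG⟩ := toy_nodes_hypotheses (θc := q) (γ := γ) hq0.le hq1.le hγ
  have h16 : NE3Shape
      ({ dom := Set.univ, act := fun _ _ => 0, loc := fun k _ _ => q ^ k, vol := 0, vol_nonneg := le_rfl } :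
        Readings Unit Unit) 1 q :=
    { rate_nonneg := hq0.le, rate_lt_one := hq1, action := fun k V _ => by simp, pointwise := hloc }
  have hθ' : max q q < (1 + q) / 2 := by rw [max_self]; linarith
  have hqθ' : q ≤ (1 + q) / 2 := by linarith
  have hθ'1 : (1 + q) / 2 < 1 := by linarith
  refine core_summable_of_nodes_u5b (C := toyCarriers) (F := ℕ) (σ := Unit) (W := Set.univ) (EA := toyEA q q)
    (EB := toyEB q q C₅) (Λm := fun k i => q ^ (k - i)) (CU := fun _ _ => (1 : ℝ)) (g := fun _ _ => γ)
    (uA := fun K _ => (q ^ K : ℝ)) (uB := fun K _ => (q ^ (K + 1) : ℝ)) (oneA := (0 : ℝ)) (oneB := (0 : ℝ))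
    (oA := fun K _ _ _ => Real.exp (-(q ^ K))) (oB := fun K _ _ _ => Real.exp (-(q ^ (K + 1))))
    (oA'' := fun K _ _ _ => Real.exp (-(∑ X ∈ range (K + 1), toyEA q q (fun _ => γ) 0 X)))
    (oB'' := fun K _ _ _ => Real.exp (-(∑ X ∈ range (K + 1), toyEB q q C₅ (fun _ => γ) 0 X)))
    (facO := fun K _ _ => ({K} : Finset ℕ)) (kindO := fun _ => Kind.boundary) (scO := fun i => i) (wO := fun _ => 1)
    (ofA := fun K _ _ _ _ => Real.exp (-(q ^ K))) (ofB := fun K _ _ _ _ => Real.exp (-(q ^ (K + 1))))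
    (cf := fun _ _ _ _ => 0)
    (μ := fun _ _ _ => Measure.dirac ()) (fac := fun K _ _ => range (K + 1)) (All := fun K => range (K + 1))
    (S := fun K _ _ j => (1 - q) * q ^ (K + j))
    (cO'' := fun K _ _ => Real.log (Real.exp (-(∑ X ∈ range (K + 1), toyEB q q C₅ (fun _ => γ) 0 X)))
      - Real.log (Real.exp (-(∑ X ∈ range (K + 1), toyEA q q (fun _ => γ) 0 X))))
    (RO'' := fun _ _ _ => 0) (rO'' := fun _ => 0)
    (Cw := 1) (E₀ := 1) (a := q) (Λ := 1) (Cl := 0) (CO := 1) (Cs := 0) (m := 0) (κ := 0) (Pg := 1) (q := 0)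
    h16 zero_le_one hgd h5 hq0.le hC₅ ⟨h9, hΛ⟩ hq0.le hinj le_rfl hq0.le hbox hU hG zero_le_one
    (fun _ => Set.mem_univ _) (fun _ => Set.mem_univ _) hθ' hqθ' hqθ' hθ'1 hθ'1.le le_rfl
    (fun _ _ _ => rfl) (fun _ _ _ => rfl) (fun _ _ _ _ _ => ⟨Integrable.of_finite, Integrable.of_finite⟩)
    (fun _ _ _ _ _ v hv => absurd (Set.mem_univ v) hv)
    (fun _ _ _ _ _ => Finset.Subset.refl _) (fun K X hX => Nat.le_of_lt_succ (mem_range.mp hX)) (fun K j hj => ?_)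
    le_rfl (fun K _ _ _ _ X hX => absurd hX (by simp))
    (fun K _ _ _ => ?_) (fun K _ _ _ => ?_) (fun K t _ τ _ v _ i hi => ?_) zero_le_one (fun _ => zero_le_one)
    (fun K _ _ _ _ i hi => ?_) (fun K _ _ _ _ j _ hjK => ?_) (fun K _ _ _ _ i _ => by simp) le_rfl
    (fun _ _ _ _ _ _ _ => ⟨Real.exp_pos _, Real.exp_pos _⟩) zero_le_one (fun K t _ τ _ v _ j hj => ?_)
    zero_le_one zero_le_one hq0 hq1 (fun K t _ τ _ j hj => ?_)
    (fun _ _ _ _ _ _ _ => by simp) (fun _ _ _ _ _ => by simp) summable_zero rfl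
    ⟨fun K => Real.log (Real.exp (-(∑ X ∈ range (K + 1), toyEB q q C₅ (fun _ => γ) 0 X)))
      - Real.log (Real.exp (-(∑ X ∈ range (K + 1), toyEA q q (fun _ => γ) 0 X))),
      fun _ => 0, summable_zero, fun K t _ τ _ => by simp⟩
  · -- `hMAll`: one domain per scale in the reference ledger
    show ∑ i ∈ range (K + 1) with i = j, Real.exp (-(0 * (0 : ℝ))) ≤ 1 * 1 * (1 : ℝ) ^ (K - j)
    rw [Finset.filter_eq', if_pos (mem_range.mpr (Nat.lt_succ_of_le hj)), sum_singleton]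
    simp
  · -- `hOfmtA`: `e^{−q^K} = e^{Σ}·(e^{−0}·(e^{−q^K}·e^{−Σ}))`
    dsimp only
    rw [prod_singleton, neg_zero, Real.exp_zero, one_mul, mul_left_comm, ← Real.exp_add, add_neg_cancel,
      Real.exp_zero, mul_one]
  · -- `hOfmtB`
    dsimp only
    rw [prod_singleton, neg_zero, Real.exp_zero, one_mul, mul_left_comm, ← Real.exp_add, add_neg_cancel,
      Real.exp_zero, mul_one]
  · -- `hU5b`: node U5b's statement for the one boundary piece: `|−q^{K+1} + q^K| = (1−q)q^K ≤ 1·(θ′^K + 0)·1`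
    rw [mem_singleton] at hi
    subst hi
    refine ⟨Real.exp_pos _, Real.exp_pos _, ?_⟩
    show |Real.log (Real.exp (-(q ^ (i + 1)))) - Real.log (Real.exp (-(q ^ i))) - 0|
      ≤ 1 * (((1 + q) / 2) ^ i + 0) * 1
    rw [Real.log_exp, Real.log_exp]
    have e : -(q ^ (i + 1)) - -(q ^ i) - 0 = (1 - q) * q ^ i := by ring
    rw [e, abs_of_nonneg (mul_nonneg (by linarith) (pow_nonneg hq0.le _)), one_mul, add_zero, mul_one]
    exact (mul_le_of_le_one_left (pow_nonneg hq0.le _) (by linarith)).trans (pow_le_pow_left₀ hq0.le hqθ' i)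
  · -- `hOrec`: the piece of index `K` is recent
    rw [mem_singleton] at hi
    subst hi
    exact ⟨jlogOf_le 0 i, le_rfl⟩
  · -- `hOM`: window multiplicity of `{K}`
    show ∑ i ∈ ({K} : Finset ℕ) with i = j, (1 : ℝ) ≤ 1 * 1 * (1 : ℝ) ^ (K - j)
    rw [Finset.filter_singleton]
    split_ifs <;> simp
  · -- `hS`: the zero-centred toy slice (as in `N19ConstantsWindowU2Output`)
    show |∑ X ∈ range (K + 1) with X = j,
        (Real.log (Real.exp (toyEB q q C₅ (fun _ => γ) (q ^ (K + 1)) X - toyEB q q C₅ (fun _ => γ) 0 X))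
          - Real.log (Real.exp (toyEA q q (fun _ => γ) (q ^ K) X - toyEA q q (fun _ => γ) 0 X)))|
      ≤ (1 - q) * q ^ (K + j)
    rw [Finset.filter_eq', if_pos (mem_range.mpr (Nat.lt_succ_of_le hj)), sum_singleton, Real.log_exp,
      Real.log_exp]
    simp only [toyEA, toyEB]
    have e : q ^ j * q ^ (K + 1) + ∑ i ∈ range j, q ^ (j - i) * γ - C₅ * q ^ j
        - (q ^ j * 0 + ∑ i ∈ range j, q ^ (j - i) * γ - C₅ * q ^ j)
        - (q ^ j * q ^ K + ∑ i ∈ range j, q ^ (j - i) * γ - (q ^ j * 0 + ∑ i ∈ range j, q ^ (j - i) * γ))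
        = -((1 - q) * q ^ (K + j)) := by ring
    rw [e, abs_neg, abs_of_nonneg (mul_nonneg (by linarith) (pow_nonneg hq0.le _))]
  · -- `hSle`
    show (1 - q) * q ^ (K + j) ≤ 1 * (1 * ((K : ℝ) + 1) ^ 0 * q ^ (K - j))
    rw [pow_zero, one_mul, one_mul, one_mul]
    exact (mul_le_of_le_one_left (pow_nonneg hq0.le _) (by linarith)).trans
      (pow_le_pow_of_le_one hq0.le hq1.le (by omega))

end Sanity

end Summit.QuantumFields.YangMills.BalabanUVNodes.N19OtherKindsU5b
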